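import Summits.QuantumFields.YangMills.Theorems.AlphaInputsT3ACv3StartSystem
import HarnessLib

/-!
# `AlphaInputsT3ACv3StartKnit` — START v3.1 for the (FL) `hLift` binder, row (S5), part 4 (knit, generic `Params`): **THE CANONICAL START FIELD IS `max(b_T, b_B)`-FLAT ON EVERY
# CONSTRAINED PLAQUETTE** — `…v3StartAssembly.dist1_plaqHol_startU_le` at the canonical system `…v3StartSystem.startSys k Ω V Mball`, with the three BALL binders DISCHARGED
# (`hdisj` from the separation of distinct vertex cubes, proved here; `hdeep`∕`hagree` from `…v3BallGraft` given the two MODEL rows (hM) boundary agreement ∕ (hP) box plaquettes of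
# `Mball v`), the tube budget read from `‖F′_Q‖ ≤ f` (`b_T := exp((2r+1)⁻²·f) − 1`), and the three LATTICE binders (hbox)∕(hsep)∕(hcov) of (S5)-4b left DISPLAYED in system letters
# — lane `pub-balaban3d` ∕ cell `ym3-torus`, seat `ym-ust-19936-w1` (g2, LEAD)

WHY (bus PROGRESS 5, 04:12Z).  This is the generic half of MAP row M21∕M22's START certificate: after it, `…v3StartT3` plugs `Mball v := ballModel R b_T (pullB v tubeSecΩ)` at `P := F.P K`
((hM)∕(hP) ⇐ `…v3BallSystem` ⇐ the shell bound), and ★w2 g2 ∕ 19936-w8 discharge (hbox)∕(hsep)∕(hcov).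
WHAT IS HERE: §1 `vertexSite_apply`, ★`eq_of_boxSite_vertexSite_eq` (charted cubes of half-side `R` around distinct vertex sites are disjoint when `2R+1 ≤ L^k` and `N₀ = N_k·L^k`),
`isBallΩ_disj` (= hdisj); §2 `htube_of_norm_le` (the tube budget from `‖F′_Q‖ ≤ f`); §3 `hdeep_of_model`, `hagree_of_model`; §4 ★★★`dist1_plaqHol_startSys_le`; §5 `startSys_apply_of_quiet`
(off the vertex cubes and the active tube bonds the start field IS the section — the (S6) line input).
HONEST FRAMING.  Bookkeeping; the lattice binders are displayed, not proved; (FL)∕`hLift` NOT proved; count-neutral helper toward R3 2′ (items 19936∕19935); registry untouched; nothing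
about d = 4, the continuum, or a mass gap; YM₃ on T³ is rung R3, not Clay.

References: T. Bałaban, Commun. Math. Phys. 102 (1985) 277–309 [Balaban1985Variational] ((11)–(15) pp.279–280); Commun. Math. Phys. 98 (1985) 17–51 [Balaban1985Averaging]
((8)–(9), (12) p.19).
-/

set_option autoImplicit false

noncomputable section

open scoped Matrix.Norms.L2Operator

namespace Summit.QuantumFields.YangMills.Theorems.TubeStart

open Literature.MathematicalPhysics.QuantumFieldTheory.Balaban1983to89
open Literature.MathematicalPhysics.QuantumFieldTheory.Balaban1983to89.T4AdjointCovarianceUnitary (lieSU expSU)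
open Literature.MathematicalPhysics.QuantumFieldTheory.Balaban1983to89.BlockAveragingSectionAction (iterSec)
open Literature.MathematicalPhysics.QuantumFieldTheory.Balaban1983to89.B10Eq38TorusDomains (toFine plaqsIn)
open Summit.QuantumFields.Balaban3D.Carriers
open Summit.QuantumFields.YangMills.Theorems.ModelBox

/-! ## §1 Vertex cubes around distinct vertices are disjoint -/

section Vertex

variable {P : Params} {k : ℕ}

/-- The vertex site's coordinates. [folklore] -/
theorem vertexSite_apply (y : Site P k) (i : Fin P.d) : vertexSite k y i = (((y i).val * P.L ^ k + (P.L ^ k - 1) : ℕ) : ZMod (P.sitesPerDir 0)) := rfl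

/-- **★ CHARTED CUBES OF HALF-SIDE `R` AROUND DISTINCT VERTEX SITES ARE DISJOINT** (`2R + 1 ≤ L^k`, `N₀ = N_k·L^k`). [folklore] -/
theorem eq_of_boxSite_vertexSite_eq (hNk : P.sitesPerDir 0 = P.sitesPerDir k * P.L ^ k) {R : ℕ} (hRL : 2 * R + 1 ≤ P.L ^ k) {y y' : Site P k} {u u' : Fin P.d → ℤ}
    (hu : InBox R u) (hu' : InBox R u') (h : boxSite (vertexSite k y) u = boxSite (vertexSite k y') u') : y = y' := by
  funext i
  have hc := congrFun h i
  simp only [boxSite, vertexSite_apply] at hc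
  -- read the equality of residues as a divisibility in ℤ
  have hc' : (((((y i).val * P.L ^ k + (P.L ^ k - 1) : ℕ) : ℤ) + u i : ℤ) : ZMod (P.sitesPerDir 0)) =
      (((((y' i).val * P.L ^ k + (P.L ^ k - 1) : ℕ) : ℤ) + u' i : ℤ) : ZMod (P.sitesPerDir 0)) := by
    push_cast at hc ⊢; exact hc
  rw [ZMod.intCast_eq_intCast_iff_dvd_sub] at hc'
  obtain ⟨c, hcdiv⟩ := hc'
  obtain ⟨hu1, hu2⟩ := hu.bounds i
  obtain ⟨hv1, hv2⟩ := hu'.bounds i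
  have hR0 : (0 : ℤ) ≤ R := Nat.cast_nonneg R
  have hRL' : (2 * R + 1 : ℤ) ≤ (P.L : ℤ) ^ k := by exact_mod_cast hRL
  have hNk' : ((P.sitesPerDir 0 : ℕ) : ℤ) = (P.sitesPerDir k : ℤ) * (P.L : ℤ) ^ k := by exact_mod_cast hNk
  have hy : ((y i).val : ℤ) < P.sitesPerDir k := by exact_mod_cast ZMod.val_lt (y i)
  have hy' : ((y' i).val : ℤ) < P.sitesPerDir k := by exact_mod_cast ZMod.val_lt (y' i)
  have hy0 : (0 : ℤ) ≤ (y i).val := Nat.cast_nonneg _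
  have hy0' : (0 : ℤ) ≤ (y' i).val := Nat.cast_nonneg _
  have hLk : (0 : ℤ) < (P.L : ℤ) ^ k := by linarith
  push_cast at hcdiv
  rw [hNk'] at hcdiv
  -- the difference is `(y' − y − c·N_k)·L^k = u − u'` with `|u − u'| < L^k`
  have key : (((y' i).val : ℤ) - (y i).val - c * (P.sitesPerDir k : ℤ)) * (P.L : ℤ) ^ k = u i - u' i := by linear_combination hcdiv
  have hsmall : |u i - u' i| < (P.L : ℤ) ^ k := by rw [abs_lt]; constructor <;> linarith
  have hzero : ((y' i).val : ℤ) - (y i).val - c * (P.sitesPerDir k : ℤ) = 0 := by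
    by_contra hne
    have h1 : (1 : ℤ) ≤ |((y' i).val : ℤ) - (y i).val - c * (P.sitesPerDir k : ℤ)| := Int.one_le_abs hne
    have h2 : (P.L : ℤ) ^ k ≤ |u i - u' i| := by
      rw [← key, abs_mul, abs_of_pos hLk]
      nlinarith
    linarith
  -- hence `c = 0` (both values lie in `[0, N_k)`) and the values agree
  have hdiff : ((y' i).val : ℤ) - (y i).val = c * (P.sitesPerDir k : ℤ) := by linarith
  have hNk0 : (0 : ℤ) ≤ (P.sitesPerDir k : ℤ) := Nat.cast_nonneg _
  have hc0 : c = 0 := by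
    rcases lt_trichotomy c 0 with hc | hc | hc
    · have : c * (P.sitesPerDir k : ℤ) ≤ -1 * (P.sitesPerDir k : ℤ) := mul_le_mul_of_nonneg_right (by omega) hNk0
      linarith
    · exact hc
    · have : 1 * (P.sitesPerDir k : ℤ) ≤ c * (P.sitesPerDir k : ℤ) := mul_le_mul_of_nonneg_right (by omega) hNk0
      linarith
  rw [hc0, zero_mul] at hdiff
  have hval : (y i).val = (y' i).val := by exact_mod_cast (by linarith : ((y i).val : ℤ) = (y' i).val)
  exact ZMod.val_injective _ hval

variable (k) (Ω : Set (Site P 0))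

/-- **(hdisj) THE VERTEX CUBES OF THE CANONICAL SYSTEM SHARE NO BOND.** [folklore] -/
theorem isBallΩ_disj (hNk : P.sitesPerDir 0 = P.sitesPerDir k * P.L ^ k) (hRL : 2 * RbT P k + 1 ≤ P.L ^ k) :
    ∀ v v' (b : PBond P 0), IsBallΩ k Ω v → IsBallΩ k Ω v' → BallBond v (RbT P k) b → BallBond v' (RbT P k) b → v = v' := by
  intro v v' b hv hv' hb hb'
  refine eq_of_ballBond_of_ballBond (R := RbT P k) (IsBall := IsBallΩ k Ω) ?_ hv hv' hb hb'
  intro w w' hw hw' hne u u' hu hu' heq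
  obtain ⟨y, -, rfl⟩ := hw
  obtain ⟨y', -, rfl⟩ := hw'
  exact hne (by rw [eq_of_boxSite_vertexSite_eq hNk hRL hu hu' heq])

end Vertex

/-! ## §2 The tube budget from `‖F′_Q‖ ≤ f` -/

section Budget

variable {P : Params} {n : Type*} [Fintype n] [DecidableEq n] [Nonempty n] (k : ℕ) (Ω : Set (Site P 0)) (V : GaugeField P k (Matrix.specialUnitaryGroup n ℂ))

/-- **THE TUBE BUDGET**: `exp(|curlB t_Q|·‖F′_Q‖) − 1 ≤ exp((2r+1)⁻²·f) − 1 =: b_T` from `‖F′_Q‖ ≤ f`. [cite: Balaban1985Variational, (14) p.280] -/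
theorem htube_of_norm_le {f : ℝ} (hf : ∀ Q, IsTubeΩ k Ω Q → ‖((FpOf k V Q : lieSU n) : Matrix n n ℂ)‖ ≤ f) :
    ∀ Q, IsTubeΩ k Ω Q → ∀ (u : Fin P.d → ℤ) (α β : Fin P.d),
      Real.exp (|curlB (tfOf k Ω Q) u α β| * ‖((FpOf k V Q : lieSU n) : Matrix n n ℂ)‖) - 1 ≤ Real.exp (((2 * (rT P k : ℝ) + 1))⁻¹ ^ 2 * f) - 1 := by
  intro Q hQ u α β
  have h1 := abs_curlB_tfOf_le_all k Ω Q u α β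
  have h2 := hf Q hQ
  have : |curlB (tfOf k Ω Q) u α β| * ‖((FpOf k V Q : lieSU n) : Matrix n n ℂ)‖ ≤ ((2 * (rT P k : ℝ) + 1))⁻¹ ^ 2 * f :=
    mul_le_mul h1 h2 (norm_nonneg _) (by positivity)
  linarith [Real.exp_le_exp.mpr this]

end Budget

/-! ## §3 The ball binders from the model rows -/

section Balls

variable {P : Params} {n : Type*} [Fintype n] [DecidableEq n] [Nonempty n] (k : ℕ) (Ω : Set (Site P 0)) (V : GaugeField P k (Matrix.specialUnitaryGroup n ℂ))
  (Mball : Site P 0 → (Fin P.d → ℤ) → Fin P.d → Matrix.specialUnitaryGroup n ℂ) (hNb : 2 * RbT P k + 1 ≤ P.sitesPerDir 0)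
include hNb

/-- **(hdeep) from (hP)**: a plaquette with its four bonds in the cube of `v` is `b_B`-flat for `ballUΩ v`. [cite: Balaban1985Variational, (11)–(14) pp.279–280] -/
theorem hdeep_of_model {bB : ℝ} (hP : ∀ v, IsBallΩ k Ω v → ∀ (u : Fin P.d → ℤ) (μ ν : Fin P.d), μ < ν → PlaqInBox (RbT P k) u μ ν → GaugeGroup.dist1 (plaqB (Mball v) u μ ν) ≤ bB)
    (C : Plaq P 0 → Prop) :
    ∀ v, IsBallΩ k Ω v → ∀ q, C q → (∀ b, Plaq.HasBond q b → BallBond v (RbT P k) b) → GaugeGroup.dist1 (GaugeField.plaqHol (ballUΩ k Ω V Mball v) q) ≤ bB := by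
  intro v hv q _ hall
  exact dist1_plaqHol_ballField_le_of_bonds v hNb (Mball v) (tubeSecΩ k Ω V) (hP v hv) q (hall _ (Or.inl rfl)) (hall _ (Or.inr (Or.inl rfl)))
    (hall _ (Or.inr (Or.inr (Or.inr rfl))))

/-- **(hagree) from (hM)**: on a cube bond of a plaquette that is not deep the ball field is stage (T). [cite: Balaban1985Variational, (11)–(13) pp.279–280] -/
theorem hagree_of_model (hM : ∀ v, IsBallΩ k Ω v → ∀ (u : Fin P.d → ℤ) (κ : Fin P.d), BdryBond (RbT P k) u κ → Mball v u κ = pullB v (tubeSecΩ k Ω V) u κ)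
    (C : Plaq P 0 → Prop) :
    ∀ v, IsBallΩ k Ω v → ∀ q, C q → ¬ Plaq.Deep (IsBallΩ k Ω) (fun v b => BallBond v (RbT P k) b) q → ∀ b, Plaq.HasBond q b → BallBond v (RbT P k) b →
      ballUΩ k Ω V Mball v b = tubeSecΩ k Ω V b := by
  intro v hv q _ hnd b hqb hb
  refine ballField_eq_of_not_all v hNb (Mball v) (tubeSecΩ k Ω V) (hM v hv) q hb hqb ?_
  rintro ⟨h1, h2, h3, h4⟩
  refine hnd ⟨v, hv, fun b' hb' => ?_⟩
  rcases hb' with rfl | rfl | rfl | rfl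
  · exact h1
  · exact h2
  · exact h3
  · exact h4

end Balls

/-! ## §4 The knit -/

section Knit

variable {P : Params} {n : Type*} [Fintype n] [DecidableEq n] [Nonempty n] (k : ℕ) (Ω : Set (Site P 0)) (V : GaugeField P k (Matrix.specialUnitaryGroup n ℂ))
  (Mball : Site P 0 → (Fin P.d → ℤ) → Fin P.d → Matrix.specialUnitaryGroup n ℂ)

open Classical in
/-- **★★★ THE CANONICAL START FIELD IS `max(b_T, b_B)`-FLAT ON EVERY CONSTRAINED PLAQUETTE** (`q ∈ plaqsIn 0 Ω`: all four corners in Ω), with `b_T := exp((2r+1)⁻²·f) − 1`.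
Binders: torus sizes `hN`, `hNb`, `hNk`, `hRL`; the tube logarithms `‖F′_Q‖ ≤ f`; the LATTICE binders (hbox)∕(hsep)∕(hcov) of (S5)-4b in system letters; the MODEL rows (hM)∕(hP) of
the ball fields. [cite: Balaban1985Variational, (11)–(15) pp.279–280] -/
theorem dist1_plaqHol_startSys_le (hN : 2 * max (RtT P k) (P.L ^ k / 2) + 1 ≤ P.sitesPerDir 0) (hNb : 2 * RbT P k + 1 ≤ P.sitesPerDir 0)
    (hNk : P.sitesPerDir 0 = P.sitesPerDir k * P.L ^ k) (hRL : 2 * RbT P k + 1 ≤ P.L ^ k) {f bB : ℝ} (hf0 : 0 ≤ f)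
    (hf : ∀ Q, IsTubeΩ k Ω Q → ‖((FpOf k V Q : lieSU n) : Matrix n n ℂ)‖ ≤ f)
    (hbox : ∀ Q, IsTubeΩ k Ω Q → ∀ q : Plaq P 0, q ∈ plaqsIn 0 Ω → ¬ Plaq.Deep (IsBallΩ k Ω) (fun v b => BallBond v (RbT P k) b) q →
      (∃ b, Plaq.HasBond q b ∧ TubeActive V (RtT P k) (FpOf k V) (tfOf k Ω) (IsTubeΩ k Ω) Q b) →
      ∃ u : Fin P.d → ℤ, q.src = boxSite (cornerSite k Q.src Q.μ Q.ν) u ∧ InTube Q.μ Q.ν (RtT P k) (P.L ^ k / 2) u ∧ InTube Q.μ Q.ν (RtT P k) (P.L ^ k / 2) (u + e q.μ) ∧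
        InTube Q.μ Q.ν (RtT P k) (P.L ^ k / 2) (u + e q.ν) ∧ InTube Q.μ Q.ν (RtT P k) (P.L ^ k / 2) (u + e q.μ + e q.ν))
    (hsep : ∀ Q Q' (q : Plaq P 0), q ∈ plaqsIn 0 Ω → ¬ Plaq.Deep (IsBallΩ k Ω) (fun v b => BallBond v (RbT P k) b) q →
      (∃ b, Plaq.HasBond q b ∧ TubeActive V (RtT P k) (FpOf k V) (tfOf k Ω) (IsTubeΩ k Ω) Q b) →
      (∃ b, Plaq.HasBond q b ∧ TubeActive V (RtT P k) (FpOf k V) (tfOf k Ω) (IsTubeΩ k Ω) Q' b) → Q = Q')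
    (hcov : ∀ q : Plaq P 0, q ∈ plaqsIn 0 Ω → ¬ Plaq.Deep (IsBallΩ k Ω) (fun v b => BallBond v (RbT P k) b) q → GaugeField.plaqHol (iterSec k V) q ≠ 1 →
      ∃ Q b, Plaq.HasBond q b ∧ TubeActive V (RtT P k) (FpOf k V) (tfOf k Ω) (IsTubeΩ k Ω) Q b)
    (hM : ∀ v, IsBallΩ k Ω v → ∀ (u : Fin P.d → ℤ) (κ : Fin P.d), BdryBond (RbT P k) u κ → Mball v u κ = pullB v (tubeSecΩ k Ω V) u κ)
    (hP : ∀ v, IsBallΩ k Ω v → ∀ (u : Fin P.d → ℤ) (μ ν : Fin P.d), μ < ν → PlaqInBox (RbT P k) u μ ν → GaugeGroup.dist1 (plaqB (Mball v) u μ ν) ≤ bB)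
    (q : Plaq P 0) (hq : q ∈ plaqsIn 0 Ω) :
    GaugeGroup.dist1 (GaugeField.plaqHol (startSys k Ω V Mball) q) ≤ max (Real.exp (((2 * (rT P k : ℝ) + 1))⁻¹ ^ 2 * f) - 1) bB := by
  have hbT : 0 ≤ Real.exp (((2 * (rT P k : ℝ) + 1))⁻¹ ^ 2 * f) - 1 := by
    have : (0 : ℝ) ≤ ((2 * (rT P k : ℝ) + 1))⁻¹ ^ 2 * f := by positivity
    linarith [Real.add_one_le_exp (((2 * (rT P k : ℝ) + 1))⁻¹ ^ 2 * f)]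
  unfold startSys
  exact dist1_plaqHol_startU_le V (RtT P k) (FpOf k V) (tfOf k Ω) (IsTubeΩ k Ω) (IsBallΩ k Ω) (fun v b => BallBond v (RbT P k) b) (ballUΩ k Ω V Mball)
    (fun q => q ∈ plaqsIn 0 Ω) hN hbT hbox hsep hcov (htube_of_norm_le k Ω V hf) (isBallΩ_disj k Ω hNk hRL) (hdeep_of_model k Ω V Mball hNb hP _)
    (hagree_of_model k Ω V Mball hNb hM _) q hq

/-! ## §5 The quiet bonds -/

/-- **OFF THE VERTEX CUBES AND THE ACTIVE TUBE BONDS THE CANONICAL START FIELD IS THE SECTION** (the (S6) line input). [cite: Balaban1985Variational, (11) p.279] -/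
theorem startSys_apply_of_quiet {b : PBond P 0} (hnb : ¬ ∃ v, IsBallΩ k Ω v ∧ BallBond v (RbT P k) b)
    (hna : ¬ ∃ Q, TubeActive V (RtT P k) (FpOf k V) (tfOf k Ω) (IsTubeΩ k Ω) Q b) : startSys k Ω V Mball b = iterSec k V b := by
  unfold startSys
  exact startU_apply_of_quiet V (RtT P k) (FpOf k V) (tfOf k Ω) (IsTubeΩ k Ω) (IsBallΩ k Ω) _ _ hnb hna

end Knit

end Summit.QuantumFields.YangMills.Theorems.TubeStart

end
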